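import Summits.CriticalPhenomena.Ising3D.Control2DCellScheme
import Summits.CriticalPhenomena.Ising3D.Control2DChiralConvex
import Mathlib.Analysis.Convex.Slope
import Mathlib.Tactic.Linarith
import Mathlib.Tactic.Positivity
import Mathlib.Tactic.Ring
import HarnessLib

/-!
# The 2D control: the SECOND-ORDER log-free cell scheme for obligation (C) — proved
(cell `pub-ising3x`, seat controls-1; mathematics of the kernel checker `Control2DCellCheck2.lean`)

HONEST FRAMING: lottery ticket; floor = tightest certified 3D Ising CFT bounds; no exact-solution
claim without a proof.

`Control2DCellScheme.lean` freezes the block factor `b_d(Δ) = brR N ℓ Δ x_d y_d` on each cell (first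
order in `b`). With `b_d` CONVEX in `Δ` (`Control2DChiralConvex.convexOn_brR`) both factors of each term
`c_d f_d(Δ) b_d(Δ)` of `Ψ` get two-sided AFFINE bounds from values only: on the cell `[t₀, t₁]`
(`H = t₁ - t₀`, `τ = Δ - t₀`), with a right stencil `t₂ > t₁` for `f` and a left stencil `t₋ < t₀` for `b`,
* positives: `f ≥ α₀ + α₁τ` (`α₀ = f(t₁) + H·D₃`, `α₁ = -D₃`, `D₃ = (f(t₁)-f(t₂))/(t₂-t₁) ≥ 0`, three-slope)
  and `b ≥ b(t₀) + D₀τ` (`D₀ = (b(t₀)-b(t₋))/(t₀-t₋) ≥ 0`, supporting secant; or `D₀ = 0`), both `≥ 0`, so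
  `c f b ≥ c(α₀ + α₁τ)(b(t₀) + D₀τ)`;
* negatives: `f ≤ f(t₀) - D₁τ` (`D₁ = (f(t₀)-f(t₁))/H`), `b ≤ b(t₀) + Uτ` (`U = (b(t₁)-b(t₀))/H`), chords,
  so `c f b ≤ c(f(t₀) - D₁τ)(b(t₀) + Uτ)`.
Hence `Ψ(t₀+τ) ≥ A + Bτ + Cτ²` with explicit `A, B, C` (`quadLB`), and `Ψ ≥ 0` on the cell follows from the
exact minimum test of a quadratic on `[0, H]` (`quad_nonneg_on`) applied to integer lower bounds of
`A, B, C` — second order in both factors, still VALUES only. This is what the sharper 2D certificates and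
the `c`-bound certificate (touching zero at `Δ_ε = 1`) need (SCOPE §4 `### controls-1 v6` (iii)).
-/

namespace Summit.CriticalPhenomena.Ising3D.Control2D

open Set Finset
open Literature.MathematicalPhysics.QuantumFieldTheory.ConformalBootstrap3D

/-! ### Affine bounds from three values -/

/-- Three-slope lower bound to the left of a secant: `F` convex on `ℝ`, `x ≤ t₁ < t₂` ⇒
`F x ≥ F t₁ + (t₁ - x)(F t₁ - F t₂)/(t₂ - t₁)`. [folklore] -/
theorem convex_left_of_secant {F : ℝ → ℝ} (hF : ConvexOn ℝ univ F) {x t₁ t₂ : ℝ} (hx : x ≤ t₁)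
    (h12 : t₁ < t₂) : F t₁ + (t₁ - x) * (F t₁ - F t₂) / (t₂ - t₁) ≤ F x := by
  rcases eq_or_lt_of_le hx with h | hlt
  · subst h; simp
  have := hF.secant_mono_aux1 (mem_univ x) (mem_univ t₂) hlt h12
  have H3 : 0 < t₂ - t₁ := by linarith
  rw [add_comm, ← le_sub_iff_add_le, div_le_iff₀ H3]
  nlinarith

/-- Supporting secant from the left, for a function convex on `Ici ℓ`: `ℓ ≤ t₋ < t₀ ≤ x` ⇒
`F x ≥ F t₀ + (x - t₀)(F t₀ - F t₋)/(t₀ - t₋)`. [folklore] -/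
theorem convex_right_of_secant {F : ℝ → ℝ} {ℓ : ℝ} (hF : ConvexOn ℝ (Ici ℓ) F) {tm t₀ x : ℝ}
    (hm : ℓ ≤ tm) (hm0 : tm < t₀) (hx : t₀ ≤ x) :
    F t₀ + (x - t₀) * (F t₀ - F tm) / (t₀ - tm) ≤ F x := by
  rcases eq_or_lt_of_le hx with h | hlt
  · subst h; simp
  have := hF.secant_mono_aux1 (show tm ∈ Ici ℓ from hm) (show x ∈ Ici ℓ by
    show ℓ ≤ x; linarith) hm0 hlt
  have H0 : 0 < t₀ - tm := by linarith
  rw [add_comm, ← le_sub_iff_add_le, div_le_iff₀ H0]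
  nlinarith

/-- Chord upper bound: `F` convex on `Ici ℓ`, `ℓ ≤ t₀ ≤ x ≤ t₁`, `t₀ < t₁` ⇒
`F x ≤ F t₀ + (x - t₀)(F t₁ - F t₀)/(t₁ - t₀)`. [folklore] -/
theorem convex_chord {F : ℝ → ℝ} {ℓ : ℝ} (hF : ConvexOn ℝ (Ici ℓ) F) {t₀ t₁ x : ℝ} (h0 : ℓ ≤ t₀)
    (h01 : t₀ < t₁) (hx0 : t₀ ≤ x) (hx1 : x ≤ t₁) :
    F x ≤ F t₀ + (x - t₀) * (F t₁ - F t₀) / (t₁ - t₀) := by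
  have H : 0 < t₁ - t₀ := by linarith
  rcases eq_or_lt_of_le hx0 with h | hlt
  · subst h; simp
  rcases eq_or_lt_of_le hx1 with h' | hlt'
  · subst h'; field_simp; linarith
  have := hF.secant_mono_aux1 (show t₀ ∈ Ici ℓ from h0) (show t₁ ∈ Ici ℓ by show ℓ ≤ t₁; linarith)
    hlt hlt'
  rw [← sub_le_iff_le_add', le_div_iff₀ H]
  nlinarith

/-! ### The per-datum bounds -/

/-- **Positive term.** With `f ≥ 0` convex on `ℝ` and non-increasing, `b ≥ 0` on `[t₀, t₁]`, a slope
`D₀ ≥ 0` with `b(t₀) + D₀τ ≤ b(t₀+τ)` on the cell, and `c ≥ 0`: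
`c f(t₀+τ) b(t₀+τ) ≥ c (f(t₁) + (t₁-t₀-τ) D₃) (b(t₀) + D₀ τ)`, `D₃ = (f t₁ - f t₂)/(t₂ - t₁)`.
[folklore] -/
theorem pos_term_bound {f b : ℝ → ℝ} (hf : ConvexOn ℝ univ f) (hfa : ∀ u v, u ≤ v → f v ≤ f u)
    (hf0 : ∀ u, 0 ≤ f u) {c t₀ t₁ t₂ D₀ τ : ℝ} (hc : 0 ≤ c) (h12 : t₁ < t₂)
    (hτ0 : 0 ≤ τ) (hτ1 : τ ≤ t₁ - t₀) (hb0 : 0 ≤ b t₀) (hD0 : 0 ≤ D₀)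
    (hbl : b t₀ + D₀ * τ ≤ b (t₀ + τ)) :
    c * ((f t₁ + (t₁ - t₀ - τ) * ((f t₁ - f t₂) / (t₂ - t₁))) * (b t₀ + D₀ * τ)) ≤
      c * (f (t₀ + τ) * b (t₀ + τ)) := by
  have H3 : 0 < t₂ - t₁ := by linarith
  have hD3 : 0 ≤ (f t₁ - f t₂) / (t₂ - t₁) := div_nonneg (by linarith [hfa t₁ t₂ h12.le]) H3.le
  have hfl : f t₁ + (t₁ - t₀ - τ) * ((f t₁ - f t₂) / (t₂ - t₁)) ≤ f (t₀ + τ) := by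
    have := convex_left_of_secant hf (show t₀ + τ ≤ t₁ by linarith) h12
    have e : (t₁ - (t₀ + τ)) * (f t₁ - f t₂) / (t₂ - t₁) = (t₁ - t₀ - τ) * ((f t₁ - f t₂) / (t₂ - t₁)) := by
      ring
    linarith
  have hL0 : 0 ≤ f t₁ + (t₁ - t₀ - τ) * ((f t₁ - f t₂) / (t₂ - t₁)) := by
    have : 0 ≤ (t₁ - t₀ - τ) * ((f t₁ - f t₂) / (t₂ - t₁)) := mul_nonneg (by linarith) hD3
    linarith [hf0 t₁]
  have hB0 : 0 ≤ b t₀ + D₀ * τ := by positivity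
  exact mul_le_mul_of_nonneg_left (mul_le_mul hfl hbl hB0 (hf0 _)) hc

/-- **Negative term.** With `f ≥ 0` convex on `ℝ`, `b ≥ 0` convex on `Ici ℓ`, `ℓ ≤ t₀ < t₁`, `c ≥ 0`, on
the cell: `c f(t₀+τ) b(t₀+τ) ≤ c (f t₀ + τ (f t₁ - f t₀)/H) (b t₀ + τ (b t₁ - b t₀)/H)`. [folklore] -/
theorem neg_term_bound {f b : ℝ → ℝ} {ℓ : ℝ} (hf : ConvexOn ℝ univ f) (hf0 : ∀ u, 0 ≤ f u)
    (hb : ConvexOn ℝ (Ici ℓ) b) (hb0 : ∀ u, ℓ ≤ u → 0 ≤ b u) {c t₀ t₁ τ : ℝ} (hc : 0 ≤ c) (hℓ : ℓ ≤ t₀)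
    (h01 : t₀ < t₁) (hτ0 : 0 ≤ τ) (hτ1 : τ ≤ t₁ - t₀) :
    c * (f (t₀ + τ) * b (t₀ + τ)) ≤
      c * ((f t₀ + τ * ((f t₁ - f t₀) / (t₁ - t₀))) * (b t₀ + τ * ((b t₁ - b t₀) / (t₁ - t₀)))) := by
  have hfu : f (t₀ + τ) ≤ f t₀ + τ * ((f t₁ - f t₀) / (t₁ - t₀)) := by
    have hf' : ConvexOn ℝ (Ici ℓ) f := hf.subset (subset_univ _) (convex_Ici ℓ)
    have := convex_chord hf' hℓ h01 (show t₀ ≤ t₀ + τ by linarith) (show t₀ + τ ≤ t₁ by linarith)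
    have e : (t₀ + τ - t₀) * (f t₁ - f t₀) / (t₁ - t₀) = τ * ((f t₁ - f t₀) / (t₁ - t₀)) := by ring
    linarith
  have hbu : b (t₀ + τ) ≤ b t₀ + τ * ((b t₁ - b t₀) / (t₁ - t₀)) := by
    have := convex_chord hb hℓ h01 (show t₀ ≤ t₀ + τ by linarith) (show t₀ + τ ≤ t₁ by linarith)
    have e : (t₀ + τ - t₀) * (b t₁ - b t₀) / (t₁ - t₀) = τ * ((b t₁ - b t₀) / (t₁ - t₀)) := by ring
    linarith
  have hfp : 0 ≤ f (t₀ + τ) := hf0 _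
  have hbp : 0 ≤ b (t₀ + τ) := hb0 _ (by linarith)
  exact mul_le_mul_of_nonneg_left (mul_le_mul hfu hbu hbp (hfp.trans hfu)) hc

/-! ### The quadratic minorant of `Ψ` on a cell -/

/-- The per-datum slope of the block factor used for positive terms: the left secant through a stencil
point `tm < t₀` when `useD0`, else `0`. [folklore] -/
noncomputable def D0of (useD0 : Bool) (b : ℝ → ℝ) (tm t₀ : ℝ) : ℝ :=
  if useD0 then (b t₀ - b tm) / (t₀ - tm) else 0

/-- `D0of` is a valid supporting slope: `≥ 0` and `b(t₀) + D₀τ ≤ b(t₀+τ)` for `b` convex and monotone on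
`Ici ℓ`, `ℓ ≤ tm < t₀`, `τ ≥ 0`. [folklore] -/
theorem D0of_spec (useD0 : Bool) {b : ℝ → ℝ} {ℓ tm t₀ τ : ℝ} (hb : ConvexOn ℝ (Ici ℓ) b)
    (hbm : ∀ u v, ℓ ≤ u → u ≤ v → b u ≤ b v) (hm : ℓ ≤ tm) (hm0 : tm < t₀) (hτ : 0 ≤ τ) :
    0 ≤ D0of useD0 b tm t₀ ∧ b t₀ + D0of useD0 b tm t₀ * τ ≤ b (t₀ + τ) := by
  unfold D0of
  cases useD0
  · simp only [Bool.false_eq_true, ↓reduceIte, zero_mul, add_zero, le_refl, true_and]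
    exact hbm _ _ (by linarith) (by linarith)
  · simp only [↓reduceIte]
    refine ⟨div_nonneg (by linarith [hbm tm t₀ hm hm0.le]) (by linarith), ?_⟩
    have := convex_right_of_secant hb hm hm0 (show t₀ ≤ t₀ + τ by linarith)
    have e : (t₀ + τ - t₀) * (b t₀ - b tm) / (t₀ - tm) = (b t₀ - b tm) / (t₀ - tm) * τ := by ring
    linarith

/-- The quadratic minorant `A + Bτ + Cτ²` of `Ψ(t₀+τ)` on a cell, summed over the data:
positives contribute `c(α₀ b₀ + (α₀ D₀ - D₃ b₀)τ - D₃ D₀ τ²)`, negatives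
`-c(f₀ b₀ + (f₀ U - D₁ b₀)τ - D₁ U τ²)`. Returned as the value at `τ`. [folklore] -/
noncomputable def quadLB (rds : List RDat) (N ℓ : ℕ) (useD0 : Bool) (tm t₀ t₁ t₂ τ : ℝ) : ℝ :=
  (rds.map fun d =>
    if d.σ then
      d.c * ((fC d.x d.y t₁ + (t₁ - t₀ - τ) * ((fC d.x d.y t₁ - fC d.x d.y t₂) / (t₂ - t₁))) *
        (brR N ℓ t₀ d.x d.y + D0of useD0 (fun t => brR N ℓ t d.x d.y) tm t₀ * τ))
    else
      -(d.c * ((fC d.x d.y t₀ + τ * ((fC d.x d.y t₁ - fC d.x d.y t₀) / (t₁ - t₀))) *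
        (brR N ℓ t₀ d.x d.y + τ * ((brR N ℓ t₁ d.x d.y - brR N ℓ t₀ d.x d.y) / (t₁ - t₀)))))).sum

/-- **`Ψ(t₀+τ) ≥ quadLB … τ`** on the cell (admissible data, `ℓ ≤ tm < t₀ < t₁ < t₂`, `0 ≤ τ ≤ t₁-t₀`).
[folklore] -/
theorem quadLB_le_PsiC {rds : List RDat} (h : ∀ d ∈ rds, d.ok) (N ℓ : ℕ) (useD0 : Bool)
    {tm t₀ t₁ t₂ τ : ℝ} (hm : (ℓ : ℝ) ≤ tm) (hm0 : tm < t₀) (h01 : t₀ < t₁) (h12 : t₁ < t₂)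
    (hτ0 : 0 ≤ τ) (hτ1 : τ ≤ t₁ - t₀) :
    quadLB rds N ℓ useD0 tm t₀ t₁ t₂ τ ≤ PsiC rds N ℓ (t₀ + τ) := by
  induction rds with
  | nil => simp [quadLB, PsiC]
  | cons d tl ih =>
    have htl : ∀ d' ∈ tl, d'.ok := fun d' hd' => h d' (List.mem_cons_of_mem _ hd')
    have hd := h d List.mem_cons_self
    have ih' := ih htl
    obtain ⟨hc, hx, hx1, hy, hy1⟩ := hd
    have hℓ0 : (ℓ : ℝ) ≤ t₀ := by linarith
    have fconv := convexOn_fC hx hy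
    have fanti : ∀ u v : ℝ, u ≤ v → fC d.x d.y v ≤ fC d.x d.y u := fun u v huv => fC_antitone hx hx1 hy hy1 huv
    have fpos : ∀ u, 0 ≤ fC d.x d.y u := fun u => fC_nonneg hx hy u
    have bconv := convexOn_brR N ℓ hx hy
    have bmono : ∀ u v : ℝ, (ℓ : ℝ) ≤ u → u ≤ v → brR N ℓ u d.x d.y ≤ brR N ℓ v d.x d.y :=
      fun u v hu huv => brR_mono N ℓ hu huv hx hy
    have bpos : ∀ u, (ℓ : ℝ) ≤ u → 0 ≤ brR N ℓ u d.x d.y := fun u hu => brR_nonneg N ℓ hu hx hy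
    simp only [quadLB, PsiC, List.map_cons, List.sum_cons] at ih' ⊢
    cases d.σ
    · simp only [Bool.false_eq_true, ↓reduceIte, neg_mul, one_mul]
      have := neg_term_bound fconv fpos bconv bpos hc hℓ0 h01 hτ0 hτ1
      linarith
    · simp only [↓reduceIte, one_mul]
      obtain ⟨hD0, hbl⟩ := D0of_spec useD0 bconv bmono hm hm0 hτ0 (t₀ := t₀)
      have := pos_term_bound (b := fun Δ => brR N ℓ Δ d.x d.y) fconv fanti fpos hc h12 hτ0 hτ1
        (bpos t₀ hℓ0) hD0 hbl
      linarith

/-! ### The minimum of a quadratic on `[0, H]` -/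

/-- **Quadratic test.** `a + bτ + cτ² ≥ 0` on `[0, H]` if `a ≥ 0`, `a + bH + cH² ≥ 0`, and the vertex is
harmless: `c ≤ 0` (concave) or `b ≥ 0` or `b + 2cH ≤ 0` (vertex outside) or `4ac ≥ b²`. [folklore] -/
theorem quad_nonneg_on {a b c H τ : ℝ} (hH : 0 < H) (h0 : 0 ≤ a) (hH' : 0 ≤ a + b * H + c * H ^ 2)
    (hv : c ≤ 0 ∨ 0 ≤ b ∨ b + 2 * c * H ≤ 0 ∨ b ^ 2 ≤ 4 * a * c) (hτ0 : 0 ≤ τ) (hτ1 : τ ≤ H) :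
    0 ≤ a + b * τ + c * τ ^ 2 := by
  rcases hv with hc | hb | hr | hd
  · -- concave: above the chord of the endpoint values
    have w1 : 0 ≤ H - τ := by linarith
    nlinarith [mul_nonneg w1 h0, mul_nonneg hτ0 hH', mul_nonneg (mul_nonneg hτ0 w1) (neg_nonneg.2 hc)]
  · rcases le_or_gt 0 c with hc | hc
    · nlinarith [mul_nonneg hτ0 hb, mul_nonneg (mul_nonneg hτ0 hτ0) hc]
    · have w1 : 0 ≤ H - τ := by linarith
      nlinarith [mul_nonneg w1 h0, mul_nonneg hτ0 hH', mul_nonneg (mul_nonneg hτ0 w1) (neg_nonneg.2 hc.le)]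
  · -- vertex to the right of H: decreasing on [0,H]
    have w1 : 0 ≤ H - τ := by linarith
    rcases le_or_gt 0 c with hc | hc
    · have : b + c * (τ + H) ≤ 0 := by nlinarith
      nlinarith [mul_nonneg w1 (neg_nonneg.2 this)]
    · nlinarith [mul_nonneg w1 h0, mul_nonneg hτ0 hH', mul_nonneg (mul_nonneg hτ0 w1) (neg_nonneg.2 hc.le)]
  · rcases le_or_gt c 0 with hc | hc
    · have w1 : 0 ≤ H - τ := by linarith
      nlinarith [mul_nonneg w1 h0, mul_nonneg hτ0 hH', mul_nonneg (mul_nonneg hτ0 w1) (neg_nonneg.2 hc)]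
    · -- completed square: 4c(a + bτ + cτ²) = (2cτ + b)² + (4ac - b²)
      nlinarith [sq_nonneg (2 * c * τ + b)]

end Summit.CriticalPhenomena.Ising3D.Control2D
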